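import Mathlib
import HarnessLib
import Summits.HubbardSuperconductivity.HubbardSuperconductivity.Theorems.KLProgrammeKLRegimeTwoVolumeTowerBaseBlockRowsGeneric
import Summits.HubbardSuperconductivity.HubbardSuperconductivity.Theorems.KLProgrammeKLRegimeTwoVolumeTowerBaseWindowCharSum

/-!
# Route `KLProgramme` — crux K3, VL child `KLRegimeVolumeLimitV17F2` (stmt-HubbardSuperconductivity-20440), base of the two-volume tower:
# `M`-UNIFORM ROWS AND COLUMNS OF A SMOOTH FREQUENCY-WINDOW SOURCE BLOCK (part 2 of lemma (α) of the window key «(VL)-SRC-WINDOW» for atom HB1,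
# pen (R225) / registrant k3c4-p1 g16; cell gate-hubbard-kl, seat p3 g18; `--supports` 20440)

The window key replaces the plain multiplier on the source copy (rows `≍ (2/π) ln M`, `…TowerBaseSrcBlockRows`) by a SMOOTH FREQUENCY WINDOW
`w_j = χ(x_j)`, `x_j = (2j + 1 − 2M)/M` (symmetric under `j ↦ 2M − 1 − j` for even `χ`), `χ ∈ C²`, `|χ| ≤ 1`, `χ ≡ 0` off `(−1, 1)` (and `χ ≡ 1` near
`0`, which is what the END read-out uses; not needed here).  With the time-torus bound of `…TowerBaseWindowCharSum` and the generic door of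
`…TowerBaseBlockRowsGeneric` this file proves that the rows and columns of the windowed source block are bounded UNIFORMLY IN `M`, the volume and `β`:

* §4 `norm_freqOnlySum_eq`, `torusSum_freqOnly_eq` — for a frequency-only family the momentum characters force the spatial difference to vanish, so the
  weighted product-torus sum (weight `1 + Λ_T·tnorm`, any `Λ_T`) is `V²` times the time-torus sum; **`freqOnlyBlock_wtRows_le`** — for ANY multiplier
  family with `F_ω(k) = w_{k₀}` (`w` real, `w_0 = 0`, `w_j = 0` for `j ≥ 2M`, `|w| ≤ s₀`, `|Δ²w| ≤ v₂`) the weighted rows of `ε • E(F)·S_{4M}` are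
  `≤ s₀ + 4M(M+1)·v₂` and the columns `≤ Ns·(s₀ + 4M(M+1)·v₂)`;
* §5 `abs_secondDiff_le` (`|χ(x+h) − 2χ(x) + χ(x−h)| ≤ c₂h²`) and **`windowBlock_wtRows_le`** — for `w_j = χ((2j+1−2M)/M)`: `s₀ = 1`, `v₂ = 4c₂/M²`,
  so rows `≤ 1 + 32·c₂` and columns `≤ Ns·(1 + 32·c₂)` for EVERY `M ≥ 1`, every volume, every `β > 0`, every `Λ_T ≥ 0` — the `M`-uniform
  replacement of conjuncts 1–2 of `hdataT` for the windowed source copy (the family is taken abstractly: any `F` with `F_ω(k) = χ(x_{k₀})`, so the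
  registrant's `…Defs` keying plugs in by `rfl`).

Proofs only; no definition.  Honest framing: finite Fourier bookkeeping; nothing here asserts any stub of 20440, K3, VL or superconductivity.
[cite: BenfattoGiulianiMastropietro2006, §2.7 (2.70)–(2.71a), §3 (3.2)–(3.8)]
-/

noncomputable section

namespace Summit.HubbardSuperconductivity.HubbardSuperconductivity.Theorems.TwoVolumeSource

set_option linter.dupNamespace false -- summit = problem name (single-conjunct summit), D-0017

open Finset Complex Literature.MathematicalPhysics.QuantumLattice GrassmannAlgebra Literature.Probability.LatticeModels
open Summit.HubbardSuperconductivity.HubbardSuperconductivity.Theorems.KLProgrammeLegKernels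
open Summit.HubbardSuperconductivity.HubbardSuperconductivity.Theorems.KLRegimeSplit
open Summit.HubbardSuperconductivity.HubbardSuperconductivity.Theorems.EngineV8
open Summit.HubbardSuperconductivity.HubbardSuperconductivity.Theorems.TwoVolumeDefect
open scoped ComplexConjugate Real

/-! ## §4 Frequency-only multiplier families: block rows from the time-torus sum -/

section Block

variable {V M : ℕ} [NeZero V] [NeZero M]

/-- **The product-torus sum of a frequency-only family factorises**: for real weights `w` on the Matsubara indices and either charge,
`‖Σ_k w_{k₀}·Χ_c(k; d, x⃗)‖ = ‖Σ_{j<2M} w_j χ_j(d)‖·V²·[x⃗ = 0]` (the momentum characters sum to `V²·[x⃗ = 0]`). [folklore] -/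
theorem norm_freqOnlySum_eq (w : ℕ → ℝ) (c : Fin 2) (d : TorusSite 1 (2 * (2 * M))) (x : TorusSite 2 V) :
    ‖∑ k : FreqMomentum V M, ((w k.1 : ℝ) : ℂ) *
        (if c = 0 then torusChar (fun _ : Fin 1 => ((k.1 : ℕ) : ZMod (2 * (2 * M)))) d * torusChar k.2 x
          else conj (torusChar (fun _ : Fin 1 => ((k.1 : ℕ) : ZMod (2 * (2 * M)))) d * torusChar k.2 x))‖ =
      ‖∑ j : Fin (2 * M), ((w j : ℝ) : ℂ) * torusChar (fun _ : Fin 1 => ((j : ℕ) : ZMod (2 * (2 * M)))) d‖ *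
        (if x = 0 then (V : ℝ) ^ 2 else 0) := by
  classical
  set A : ℂ := ∑ j : Fin (2 * M), ((w j : ℝ) : ℂ) * torusChar (fun _ : Fin 1 => ((j : ℕ) : ZMod (2 * (2 * M)))) d with hA
  set B : ℂ := ∑ p : TorusSite 2 V, torusChar p x with hB
  have hBv : B = if x = 0 then (V : ℂ) ^ 2 else 0 := sum_torusChar_left x
  have hnB : ‖B‖ = if x = 0 then (V : ℝ) ^ 2 else 0 := by
    rw [hBv]
    split_ifs <;> simp
  by_cases hc : c = 0
  · simp only [hc, ↓reduceIte]
    have h : ∑ k : FreqMomentum V M, ((w k.1 : ℝ) : ℂ) * (torusChar (fun _ : Fin 1 => ((k.1 : ℕ) : ZMod (2 * (2 * M)))) d * torusChar k.2 x) =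
        A * B := by
      rw [hA, hB, Fintype.sum_prod_type, Finset.sum_mul_sum]
      exact Finset.sum_congr rfl fun j _ => Finset.sum_congr rfl fun p _ => by ring
    rw [h, norm_mul, hnB]
  · simp only [hc, ↓reduceIte]
    have h : ∑ k : FreqMomentum V M, ((w k.1 : ℝ) : ℂ) * conj (torusChar (fun _ : Fin 1 => ((k.1 : ℕ) : ZMod (2 * (2 * M)))) d * torusChar k.2 x) =
        conj (A * B) := by
      rw [hA, hB, map_mul, map_sum, map_sum, Fintype.sum_prod_type, Finset.sum_mul_sum]
      refine Finset.sum_congr rfl fun j _ => Finset.sum_congr rfl fun p _ => ?_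
      simp only [map_mul, Complex.conj_ofReal]
      ring
    rw [h, Complex.norm_conj, norm_mul, hnB]

/-- The torus sup-norm of the zero site vanishes (local copy of the one-liner; `Torus.tnorm_proj_le` at the origin). [folklore] -/
private theorem tnorm_zero_loc {d L : ℕ} [NeZero L] : Torus.tnorm (0 : TorusSite d L) = 0 := by
  have h : Torus.tnorm (0 : TorusSite d L) ≤ Site.supNorm (0 : Site d) := by
    have h1 := Torus.tnorm_proj_le (L := L) (0 : Site d)
    have h0 : Torus.proj L (0 : Site d) = 0 := by
      funext i
      simp [Torus.proj_apply]
    rwa [h0] at h1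
  have h2 : Site.supNorm (0 : Site d) = 0 := Nat.le_zero.1 (Site.supNorm_le_iff.2 fun i => by simp)
  exact Nat.le_zero.1 (h2 ▸ h)

/-- **The weighted product-torus sum of a frequency-only family** is `V²` times the time-torus sum (the weight `1 + Λ_T·tnorm x⃗` is `1` at the only
contributing spatial difference `x⃗ = 0`). [folklore] -/
theorem torusSum_freqOnly_eq (w : ℕ → ℝ) (ΛT : ℝ) (c : Fin 2) :
    ∑ dw : TorusSite 1 (2 * (2 * M)) × TorusSite 2 V, (1 + ΛT * (Torus.tnorm dw.2 : ℝ)) *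
        ‖∑ k : FreqMomentum V M, ((w k.1 : ℝ) : ℂ) *
          (if c = 0 then torusChar (fun _ : Fin 1 => ((k.1 : ℕ) : ZMod (2 * (2 * M)))) dw.1 * torusChar k.2 dw.2
            else conj (torusChar (fun _ : Fin 1 => ((k.1 : ℕ) : ZMod (2 * (2 * M)))) dw.1 * torusChar k.2 dw.2))‖ =
      (V : ℝ) ^ 2 * ∑ d : TorusSite 1 (2 * (2 * M)), ‖∑ j : Fin (2 * M), ((w j : ℝ) : ℂ) * torusChar (fun _ : Fin 1 => ((j : ℕ) : ZMod (2 * (2 * M)))) d‖ := by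
  classical
  simp_rw [norm_freqOnlySum_eq w c]
  rw [Fintype.sum_prod_type, Finset.mul_sum]
  refine Finset.sum_congr rfl fun d _ => ?_
  dsimp only
  rw [Fintype.sum_eq_single (0 : TorusSite 2 V) fun x hx => by rw [if_neg hx, mul_zero, mul_zero]]
  rw [if_pos rfl, tnorm_zero_loc, Nat.cast_zero, mul_zero, add_zero, one_mul, mul_comm]

/-- **WEIGHTED ROWS AND COLUMNS OF A FREQUENCY-ONLY OVERLAP BLOCK**: for any multiplier family with `F_ω(k) = w_{k₀}` (real weights `w` vanishing at
`j = 0` and for `j ≥ 2M`, `|w_j| ≤ s₀`, `|w_j − 2w_{j−1} + w_{j−2}| ≤ v₂`), every `β > 0`, every volume and every rate `Λ_T ≥ 0`: the rows of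
`ε • E(F)·S_{4M}` weighted by `1 + Λ_T·tnorm(x⃗_Y − x⃗_y)` are `≤ s₀ + 4M(M+1)·v₂` and the columns `≤ Ns·(s₀ + 4M(M+1)·v₂)`.
[cite: BenfattoGiulianiMastropietro2006, §2.7 (2.70)–(2.71a)] -/
theorem freqOnlyBlock_wtRows_le {Ns : ℕ} {β : ℝ} (hβ : 0 < β) {F : Fin Ns → FreqMomentum V M → ℂ} {w : ℕ → ℝ}
    (hF : ∀ ω k, F ω k = ((w k.1 : ℝ) : ℂ)) (hw0 : w 0 = 0) (hw2M : ∀ m, 2 * M ≤ m → w m = 0) {s₀ v₂ : ℝ}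
    (hs : ∀ m, |w m| ≤ s₀) (hv : ∀ m, |w m - 2 * w (m - 1) + w (m - 2)| ≤ v₂) {ΛT : ℝ} (hΛT : 0 ≤ ΛT) :
    (∀ Y : SpaceTimeIdx V M × SectorLeg Ns, ∑ y : GridLeg (GridPoint V (klGridN M)),
        ‖((((imagTimeWeight β M : ℝ) : ℂ) • sectorAnalysisMatrix V M β F) * hubbardGridSub V M β (klGridN M)) Y y‖ *
          (1 + ΛT * (Torus.tnorm (Y.1.2 - y.1.1.2) : ℝ)) ≤ s₀ + 4 * M * (M + 1) * v₂) ∧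
    (∀ y : GridLeg (GridPoint V (klGridN M)), ∑ Y : SpaceTimeIdx V M × SectorLeg Ns,
        ‖((((imagTimeWeight β M : ℝ) : ℂ) • sectorAnalysisMatrix V M β F) * hubbardGridSub V M β (klGridN M)) Y y‖ *
          (1 + ΛT * (Torus.tnorm (Y.1.2 - y.1.1.2) : ℝ)) ≤ Ns * (s₀ + 4 * M * (M + 1) * v₂)) := by
  classical
  have hM0 : (0 : ℝ) < M := Nat.cast_pos.2 (Nat.pos_of_ne_zero (NeZero.ne M))
  have hV0 : (0 : ℝ) < V := Nat.cast_pos.2 (Nat.pos_of_ne_zero (NeZero.ne V))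
  -- the time-torus sum of the complexified weights
  set Tt : ℝ := ∑ d : TorusSite 1 (2 * (2 * M)),
    ‖∑ j : Fin (2 * M), ((w j : ℝ) : ℂ) * torusChar (fun _ : Fin 1 => ((j : ℕ) : ZMod (2 * (2 * M)))) d‖ with hTt
  have hTt_le : 1 / (2 * (M : ℝ)) * Tt ≤ s₀ + 4 * M * (M + 1) * v₂ := by
    refine sum_norm_weightedCharSum_le M (fun m => ((w m : ℝ) : ℂ)) (by simp [hw0]) (fun m hm => by simp [hw2M m hm])
      (fun m => ?_) (fun m => ?_)
    · rw [Complex.norm_real, Real.norm_eq_abs]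
      exact hs m
    · have h : ((w m : ℝ) : ℂ) - 2 * ((w (m - 1) : ℝ) : ℂ) + ((w (m - 2) : ℝ) : ℂ) = ((w m - 2 * w (m - 1) + w (m - 2) : ℝ) : ℂ) := by
        push_cast
        ring
      rw [h, Complex.norm_real, Real.norm_eq_abs]
      exact hv m
  -- the torus-sum hypothesis of `…TowerBaseBlockRowsGeneric` with `T := Tt/|β|`
  have hβ' : 0 < |β| := abs_pos.2 hβ.ne'
  have hT : ∀ (ω : Fin Ns) (c : Fin 2), 1 / (|β| * (V : ℝ) ^ 2) *
      ∑ dw : TorusSite 1 (2 * (2 * M)) × TorusSite 2 V, (1 + ΛT * (Torus.tnorm dw.2 : ℝ)) *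
        ‖∑ k : FreqMomentum V M, F ω k *
          (if c = 0 then torusChar (fun _ : Fin 1 => ((k.1 : ℕ) : ZMod (2 * (2 * M)))) dw.1 * torusChar k.2 dw.2
            else conj (torusChar (fun _ : Fin 1 => ((k.1 : ℕ) : ZMod (2 * (2 * M)))) dw.1 * torusChar k.2 dw.2))‖ ≤ Tt / |β| := by
    intro ω c
    simp only [hF]
    rw [torusSum_freqOnly_eq w ΛT c, ← hTt]
    apply le_of_eq
    field_simp
  have hε : imagTimeWeight β M * (Tt / |β|) = 1 / (2 * (M : ℝ)) * Tt := by
    rw [imagTimeWeight, abs_of_pos hβ]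
    field_simp
  refine ⟨fun Y => ?_, fun y => ?_⟩
  · have h := sum_norm_smulOverlap_mul_wt_row_le_of_torusSum (V := V) (M := M) hβ F hT Y
    rw [hε] at h
    exact h.trans hTt_le
  · have h := sum_norm_smulOverlap_mul_wt_col_le_of_torusSum (V := V) (M := M) hβ F hΛT hT y
    rw [hε] at h
    exact h.trans (mul_le_mul_of_nonneg_left hTt_le (Nat.cast_nonneg _))

end Block

/-! ## §5 The smooth window: second differences and the `M`-uniform rows -/

/-- **Second differences of a `C²` function**: `|χ(x + h) − 2χ(x) + χ(x − h)| ≤ c₂·h²` when `|χ''| ≤ c₂` (the mean value theorem twice). [folklore] -/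
theorem abs_secondDiff_le {χ : ℝ → ℝ} (hχ : ContDiff ℝ 2 χ) {c₂ : ℝ} (hc₂ : ∀ x, |iteratedDeriv 2 χ x| ≤ c₂) (x h : ℝ) :
    |χ (x + h) - 2 * χ x + χ (x - h)| ≤ c₂ * h ^ 2 := by
  have hd : Differentiable ℝ χ := hχ.differentiable (by norm_num)
  have hd1 : Differentiable ℝ (deriv χ) := by
    have h1 := hχ.differentiable_iteratedDeriv 1 (by norm_num)
    rwa [iteratedDeriv_one] at h1
  have hd2 : ∀ t, |deriv (deriv χ) t| ≤ c₂ := fun t => by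
    have h2 := hc₂ t
    rwa [iteratedDeriv_succ, iteratedDeriv_one] at h2
  -- `χ'` is `c₂`-Lipschitz
  have hlip : ∀ a b : ℝ, |deriv χ b - deriv χ a| ≤ c₂ * |b - a| := fun a b => by
    have hl := Convex.norm_image_sub_le_of_norm_deriv_le (f := deriv χ) (s := Set.univ) (fun t _ => hd1 t)
      (fun t _ => by rw [Real.norm_eq_abs]; exact hd2 t) convex_univ (Set.mem_univ a) (Set.mem_univ b)
    rwa [Real.norm_eq_abs, Real.norm_eq_abs] at hl
  -- `g(t) = χ(t + h) − χ(t)` has derivative `χ'(t + h) − χ'(t)`, of size `≤ c₂|h|`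
  set g : ℝ → ℝ := fun t => χ (t + h) - χ t with hg
  have hgd : ∀ t, HasDerivAt g (deriv χ (t + h) - deriv χ t) t := fun t =>
    (HasDerivAt.comp_add_const t h (hd (t + h)).hasDerivAt).sub (hd t).hasDerivAt
  have hg' : ∀ t, |deriv g t| ≤ c₂ * |h| := fun t => by
    rw [(hgd t).deriv]
    have hl := hlip t (t + h)
    rwa [add_sub_cancel_left] at hl
  have hglip := Convex.norm_image_sub_le_of_norm_deriv_le (f := g) (s := Set.univ) (fun t _ => (hgd t).differentiableAt)
    (fun t _ => by rw [Real.norm_eq_abs]; exact hg' t) convex_univ (Set.mem_univ (x - h)) (Set.mem_univ x)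
  rw [Real.norm_eq_abs, Real.norm_eq_abs] at hglip
  have hid : g x - g (x - h) = χ (x + h) - 2 * χ x + χ (x - h) := by
    simp only [hg, sub_add_cancel]
    ring
  rw [← hid]
  calc |g x - g (x - h)| ≤ c₂ * |h| * |x - (x - h)| := hglip
    _ = c₂ * h ^ 2 := by rw [sub_sub_cancel, mul_assoc, abs_mul_abs_self, pow_two]

section Window

variable {V M : ℕ} [NeZero V] [NeZero M]

/-- **`M`-UNIFORM WEIGHTED ROWS AND COLUMNS OF THE SMOOTH-WINDOW SOURCE BLOCK** (lemma (α) of the window key): for a `C²` window `χ` with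
`|χ''| ≤ c₂`, `|χ| ≤ 1` and `χ(x) = 0` for `|x| ≥ 1`, any multiplier family with `F_ω(k) = χ((2k₀ + 1 − 2M)/M)`, every `β > 0`, every volume `V`,
every time cutoff `M ≥ 1` and every rate `Λ_T ≥ 0`: the rows of `ε • E(F)·S_{4M}` weighted by `1 + Λ_T·tnorm(x⃗_Y − x⃗_y)` are `≤ 1 + 32·c₂` and the
columns `≤ Ns·(1 + 32·c₂)` — conjuncts 1–2 of `hdataT` for the windowed source copy, uniformly in `M`.
[cite: BenfattoGiulianiMastropietro2006, §2.7 (2.70)–(2.71a), §3 (3.2)–(3.8)] -/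
theorem windowBlock_wtRows_le {Ns : ℕ} {β : ℝ} (hβ : 0 < β) {χ : ℝ → ℝ} (hχ : ContDiff ℝ 2 χ) {c₂ : ℝ}
    (hc₂ : ∀ x, |iteratedDeriv 2 χ x| ≤ c₂) (hχ1 : ∀ x, |χ x| ≤ 1) (hχ0 : ∀ x, 1 ≤ |x| → χ x = 0)
    {F : Fin Ns → FreqMomentum V M → ℂ} (hF : ∀ ω k, F ω k = ((χ ((2 * (k.1 : ℕ) + 1 - 2 * M) / M) : ℝ) : ℂ)) {ΛT : ℝ} (hΛT : 0 ≤ ΛT) :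
    (∀ Y : SpaceTimeIdx V M × SectorLeg Ns, ∑ y : GridLeg (GridPoint V (klGridN M)),
        ‖((((imagTimeWeight β M : ℝ) : ℂ) • sectorAnalysisMatrix V M β F) * hubbardGridSub V M β (klGridN M)) Y y‖ *
          (1 + ΛT * (Torus.tnorm (Y.1.2 - y.1.1.2) : ℝ)) ≤ 1 + 32 * c₂) ∧
    (∀ y : GridLeg (GridPoint V (klGridN M)), ∑ Y : SpaceTimeIdx V M × SectorLeg Ns,
        ‖((((imagTimeWeight β M : ℝ) : ℂ) • sectorAnalysisMatrix V M β F) * hubbardGridSub V M β (klGridN M)) Y y‖ *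
          (1 + ΛT * (Torus.tnorm (Y.1.2 - y.1.1.2) : ℝ)) ≤ Ns * (1 + 32 * c₂)) := by
  have hM0 : (0 : ℝ) < M := Nat.cast_pos.2 (Nat.pos_of_ne_zero (NeZero.ne M))
  have hM1 : (1 : ℝ) ≤ M := by exact_mod_cast Nat.pos_of_ne_zero (NeZero.ne M)
  have hc0 : 0 ≤ c₂ := le_trans (abs_nonneg _) (hc₂ 0)
  have h1M : 1 / (M : ℝ) ≤ 1 := by rw [div_le_one hM0]; exact hM1
  set w : ℕ → ℝ := fun m => χ ((2 * (m : ℝ) + 1 - 2 * M) / M) with hw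
  have hF' : ∀ ω k, F ω k = ((w k.1 : ℝ) : ℂ) := fun ω k => by rw [hF]
  -- vanishing at `0` and beyond `2M`
  have hw0 : w 0 = 0 := by
    simp only [hw, Nat.cast_zero, mul_zero, zero_add]
    refine hχ0 _ (le_abs.2 (Or.inr ?_))
    have hid : -((1 - 2 * (M : ℝ)) / M) = 2 - 1 / M := by
      field_simp
      ring
    rw [hid]
    linarith
  have hw2M : ∀ m, 2 * M ≤ m → w m = 0 := fun m hm => by
    simp only [hw]
    refine hχ0 _ (le_abs.2 (Or.inl ?_))
    have hm' : (2 * M : ℝ) ≤ m := by exact_mod_cast hm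
    rw [le_div_iff₀ hM0]
    linarith
  have hs : ∀ m, |w m| ≤ 1 := fun m => hχ1 _
  -- second differences `≤ 4c₂/M²`
  have hv : ∀ m, |w m - 2 * w (m - 1) + w (m - 2)| ≤ 4 * c₂ / (M : ℝ) ^ 2 := by
    intro m
    rcases Nat.eq_zero_or_pos m with rfl | hm
    · show |w 0 - 2 * w 0 + w 0| ≤ 4 * c₂ / (M : ℝ) ^ 2
      have hz : w 0 - 2 * w 0 + w 0 = 0 := by ring
      rw [hz, abs_zero]
      positivity
    · -- `m ≥ 1`: a symmetric second difference at `x₀ = (2(m−1)+1−2M)/M` with step `2/M`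
      set x₀ : ℝ := (2 * ((m - 1 : ℕ) : ℝ) + 1 - 2 * M) / M with hx₀
      have hcast : ((m - 1 : ℕ) : ℝ) = m - 1 := by
        rw [Nat.cast_sub hm]
        simp
      have h1 : w m = χ (x₀ + 2 / M) := by
        show χ ((2 * (m : ℝ) + 1 - 2 * M) / M) = χ (x₀ + 2 / M)
        congr 1
        rw [hx₀, hcast]
        field_simp
        ring
      have h2 : w (m - 1) = χ x₀ := rfl
      have h3 : w (m - 2) = χ (x₀ - 2 / M) := by
        rcases Nat.lt_or_ge m 2 with hm2 | hm2
        · -- `m = 1`: both sides vanish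
          have hl : w (m - 2) = 0 := by
            rw [show m - 2 = 0 by omega]
            exact hw0
          have hr : χ (x₀ - 2 / M) = 0 := by
            refine hχ0 _ (le_abs.2 (Or.inr ?_))
            rw [hx₀, show m - 1 = 0 by omega, Nat.cast_zero, mul_zero, zero_add]
            have hid : -((1 - 2 * (M : ℝ)) / M - 2 / M) = 2 + 1 / M := by
              field_simp
              ring
            rw [hid]
            have : 0 < 1 / (M : ℝ) := by positivity
            linarith
          rw [hl, hr]
        · have hcast2 : ((m - 2 : ℕ) : ℝ) = m - 2 := by
            rw [Nat.cast_sub hm2]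
            simp
          show χ ((2 * ((m - 2 : ℕ) : ℝ) + 1 - 2 * M) / M) = χ (x₀ - 2 / M)
          congr 1
          rw [hx₀, hcast, hcast2]
          field_simp
          ring
      rw [h1, h2, h3]
      calc |χ (x₀ + 2 / M) - 2 * χ x₀ + χ (x₀ - 2 / M)| ≤ c₂ * (2 / M) ^ 2 := abs_secondDiff_le hχ hc₂ x₀ (2 / M)
        _ = 4 * c₂ / (M : ℝ) ^ 2 := by
          field_simp
          ring
  have h := freqOnlyBlock_wtRows_le (V := V) (M := M) hβ hF' hw0 hw2M hs hv hΛT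
  -- `1 + 4M(M+1)·(4c₂/M²) = 1 + 16c₂·(M+1)/M ≤ 1 + 32c₂`
  have hbound : 1 + 4 * (M : ℝ) * (M + 1) * (4 * c₂ / (M : ℝ) ^ 2) ≤ 1 + 32 * c₂ := by
    have hid : 4 * (M : ℝ) * (M + 1) * (4 * c₂ / (M : ℝ) ^ 2) = 16 * c₂ * (1 + 1 / M) := by
      field_simp
      ring
    rw [hid]
    nlinarith
  exact ⟨fun Y => (h.1 Y).trans hbound, fun y => (h.2 y).trans (mul_le_mul_of_nonneg_left hbound (Nat.cast_nonneg _))⟩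

end Window

end Summit.HubbardSuperconductivity.HubbardSuperconductivity.Theorems.TwoVolumeSource

end
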